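import Mathlib
import Summits.Ventures.PercRepro2.HCov
import Summits.Ventures.PercRepro2.GcSkelRules
import Summits.Ventures.PercRepro2.GcSumEmbed

/-!
# The series and parallel expansions of one edge (blind cell PercRepro2, typer-1 g58)

The series rule `Gc_series_at` and the parallel rule `Gc_parallel` of the weighted lane REMOVE a
degree-two vertex / a parallel edge. Read backwards, on the extended types of `GcSumEmbed.lean`,
they ADD one: an edge `f = {x, w}` of weight `s · t` is the path `x – y – w` through a new vertex
`y` with weights `s, t` (**`Gc_series_expand`**), an edge `f` of weight `s + t − st` is the pair of
parallel edges of weights `s, t` (**`Gc_parallel_expand`**) — exact identities of `Gc`, at every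
weight, on `V ⊕ Unit`, `E ⊕ Unit`. With `s = ½` they are the two steps of the dyadic expansion of
`GcHalf.lean`: every dyadic weight `m / 2^k` in `(0, 1)` is `(b + q) / 2` with `b ∈ {0, 1}` and
`q = m' / 2^(k−1)`, i.e. a ½-edge in series (`b = 0`) or in parallel (`b = 1`) with a `q`-edge.

* `seriesEnds ends f x w` — the edge `f` becomes `{y, w}` (`y = Sum.inr ()`), the spare edge
  `Sum.inr ()` becomes `{x, y}`; `contractRootEdge_seriesEnds`: contracting `{x, y}` onto `x` gives
  back the extended instance with a loop at `x`;
* `parallelEnds ends f` — the spare edge is a second copy of `f`; `update_parallelEnds`: re-routing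
  it to a loop gives back the extended instance;
* `Gc_update_of_isDiag` — the weight of a loop is invisible to `Gc` (`Gc_update_zero_eq_loop`).

Standard axioms.
-/

namespace Summit.Ventures.PercRepro2

open CovForm Contract RECM

namespace Expand

/-! ## The two extended incidence maps -/

section DefsPlain

variable {V E : Type*}

/-- A loop at `Sum.inl x` on the spare edge. -/
def loopAt (x : V) : Unit → Sym2 (V ⊕ Unit) := fun _ => s(Sum.inl x, Sum.inl x)

/-- The loop is a loop. -/
lemma loopAt_isDiag (x : V) : ∀ u : Unit, (loopAt x u).IsDiag := fun _ => by
  simp [loopAt]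

/-- **The parallel expansion of the edge `f`**: the spare edge `Sum.inr ()` is a second copy of `f`;
every edge of `E` is carried by `Sum.inl`. -/
def parallelEnds (ends : E → Sym2 V) (f : E) : E ⊕ Unit → Sym2 (V ⊕ Unit) :=
  Types.extEnds ends (fun _ => (ends f).map Sum.inl)

/-- `parallelEnds` at an edge of `E`. -/
@[simp] lemma parallelEnds_inl (ends : E → Sym2 V) (f : E) (g : E) :
    parallelEnds ends f (Sum.inl g) = (ends g).map Sum.inl := rfl

/-- `parallelEnds` at the spare edge. -/
@[simp] lemma parallelEnds_inr (ends : E → Sym2 V) (f : E) (u : Unit) :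
    parallelEnds ends f (Sum.inr u) = (ends f).map Sum.inl := rfl

end DefsPlain

section Defs

variable {V E : Type*} [DecidableEq E]

/-- **The series expansion of the edge `f = {x, w}`**: on `V ⊕ Unit`, `E ⊕ Unit` the edge `f` joins
the new vertex `y = Sum.inr ()` to `w`, and the spare edge `Sum.inr ()` joins `x` to `y`; every
other edge is carried by `Sum.inl`. -/
def seriesEnds (ends : E → Sym2 V) (f : E) (x w : V) : E ⊕ Unit → Sym2 (V ⊕ Unit) :=
  Sum.elim (Function.update (fun e => (ends e).map Sum.inl) f s(Sum.inr (), Sum.inl w))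
    (fun _ => s(Sum.inl x, Sum.inr ()))

/-- `seriesEnds` at the edge `f`. -/
@[simp] lemma seriesEnds_inl_self (ends : E → Sym2 V) (f : E) (x w : V) :
    seriesEnds ends f x w (Sum.inl f) = s(Sum.inr (), Sum.inl w) := by
  simp [seriesEnds]

/-- `seriesEnds` at an edge other than `f`. -/
lemma seriesEnds_inl_of_ne (ends : E → Sym2 V) (f : E) (x w : V) {g : E} (hg : g ≠ f) :
    seriesEnds ends f x w (Sum.inl g) = (ends g).map Sum.inl := by
  simp [seriesEnds, Function.update_of_ne hg]

/-- `seriesEnds` at the spare edge. -/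
@[simp] lemma seriesEnds_inr (ends : E → Sym2 V) (f : E) (x w : V) (u : Unit) :
    seriesEnds ends f x w (Sum.inr u) = s(Sum.inl x, Sum.inr ()) := rfl

end Defs

/-! ## The contraction and the re-routing give back the extended instance -/

section Back

variable {V E : Type*} [DecidableEq V] [DecidableEq E]

/-- The contraction map of `{Sum.inl x, Sum.inr ()}` onto `Sum.inl x` fixes `Sum.inl`. -/
lemma contractMap_comp_inl (x : V) :
    contractMap ({Sum.inl x, Sum.inr ()} : Finset (V ⊕ Unit)) (Sum.inl x) ∘ Sum.inl = Sum.inl := by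
  funext v
  simp only [Function.comp_apply, contractMap, Finset.mem_insert, Finset.mem_singleton,
    Sum.inl.injEq, reduceCtorEq, or_false]
  split_ifs with h
  · rw [h]
  · rfl

/-- **Contracting `{x, y}` in the series expansion** gives back the extended instance with the spare
edge a loop at `x`. -/
lemma contractRootEdge_seriesEnds (ends : E → Sym2 V) {f : E} {x w : V} (hf : ends f = s(x, w))
    (hxw : x ≠ w) :
    contractRootEdge (seriesEnds ends f x w) (Sum.inl x) (Sum.inr ()) =
      Types.extEnds ends (loopAt x) := by
  funext e'
  rcases e' with g | ⟨⟩
  · rw [contractRootEdge, contractEnds_apply, Types.extEnds_inl]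
    by_cases hg : g = f
    · subst hg
      rw [seriesEnds_inl_self, hf, Sym2.map_mk, Sym2.map_mk]
      simp [contractMap, Ne.symm hxw]
    · rw [seriesEnds_inl_of_ne ends f x w hg, Sym2.map_map, contractMap_comp_inl]
  · rw [contractRootEdge, contractEnds_apply, seriesEnds_inr, Sym2.map_mk]
    simp [contractMap, loopAt]

omit [DecidableEq V] in
/-- **Re-routing the spare copy to a loop** in the parallel expansion gives back the extended
instance. -/
lemma update_parallelEnds (ends : E → Sym2 V) (f : E) (x : V) :
    Function.update (parallelEnds ends f) (Sum.inr ()) s(Sum.inl x, Sum.inl x) =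
      Types.extEnds ends (loopAt x) := by
  funext e'
  rcases e' with g | ⟨⟩
  · have hne : (Sum.inl g : E ⊕ Unit) ≠ Sum.inr () := Sum.inl_ne_inr
    rw [Function.update_of_ne hne]
    rfl
  · rw [Function.update_self]
    rfl

end Back

/-! ## The weights -/

section Weights

variable {E : Type*} [DecidableEq E] {R : Type*} [Field R]

/-- The series weights `Sum.elim p[f ↦ t] (· ↦ s)`, contracted: `s · t = p f` gives back
`Sum.elim p 0`. -/
lemma series_weights (p : E → R) {f : E} {s t : R} (hst : p f = s * t) :
    Function.update (Function.update (Sum.elim (Function.update p f t) (fun _ : Unit => s))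
      (Sum.inl f) (s * t)) (Sum.inr ()) 0 = Sum.elim p (fun _ : Unit => (0 : R)) := by
  funext e'
  rcases e' with g | ⟨⟩
  · have hne : (Sum.inl g : E ⊕ Unit) ≠ Sum.inr () := Sum.inl_ne_inr
    by_cases hg : g = f
    · subst hg
      simp only [Function.update_of_ne hne, Function.update_self, Sum.elim_inl, hst]
    · simp only [Function.update_of_ne hne, Function.update_of_ne (Sum.inl_injective.ne hg),
        Sum.elim_inl, Function.update_of_ne hg]
  · simp only [Function.update_self, Sum.elim_inr]

/-- The parallel weights `Sum.elim p[f ↦ t] (· ↦ s)`, merged: `t + s − t s = p f` gives back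
`Sum.elim p 0`. -/
lemma parallel_weights (p : E → R) {f : E} {s t : R} (hst : p f = t + s - t * s) :
    Function.update (Function.update (Sum.elim (Function.update p f t) (fun _ : Unit => s))
      (Sum.inl f) (t + s - t * s)) (Sum.inr ()) 0 = Sum.elim p (fun _ : Unit => (0 : R)) := by
  funext e'
  rcases e' with g | ⟨⟩
  · have hne : (Sum.inl g : E ⊕ Unit) ≠ Sum.inr () := Sum.inl_ne_inr
    by_cases hg : g = f
    · subst hg
      simp only [Function.update_of_ne hne, Function.update_self, Sum.elim_inl, hst]
    · simp only [Function.update_of_ne hne, Function.update_of_ne (Sum.inl_injective.ne hg),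
        Sum.elim_inl, Function.update_of_ne hg]
  · simp only [Function.update_self, Sum.elim_inr]

end Weights

/-! ## A loop edge takes any weight -/

section Loop

variable {V E : Type*} [Fintype E] [DecidableEq E] {R : Type*} [Field R]

/-- The weight of a loop is invisible to `Gc`. -/
lemma Gc_update_of_isDiag (p : E → R) {ends : E → Sym2 V} {e : E} (he : (ends e).IsDiag)
    (q : R) (o a₁ a₂ a₃ b : V) :
    Gc p ends o a₁ a₂ a₃ b = Gc (Function.update p e q) ends o a₁ a₂ a₃ b := by
  obtain ⟨⟨x, y⟩, hxy⟩ := Quot.exists_rep (ends e)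
  have he' : ends e = s(x, y) := hxy.symm
  rw [he', Sym2.mk_isDiag_iff] at he
  subst he
  have h1 := RECM.Gc_update_zero_eq_loop p ends e x o a₁ a₂ a₃ b
  have h2 := RECM.Gc_update_zero_eq_loop (Function.update p e q) ends e x o a₁ a₂ a₃ b
  rw [Function.update_idem] at h2
  have h3 : Function.update ends e s(x, x) = ends := by
    rw [← he']
    exact Function.update_eq_self e ends
  rw [h3] at h1 h2
  exact h1.symm.trans h2

end Loop

/-! ## The two expansion identities -/

section Main

variable {V E : Type*} [Fintype E] [DecidableEq E] [DecidableEq V] {R : Type*} [Field R]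

omit [DecidableEq V] in
/-- The new vertex `Sum.inr ()` is unmarked. -/
lemma unmarked_inr (o a₁ a₂ a₃ b : V) :
    Unmarked (Sum.inl o) (Sum.inl a₁) (Sum.inl a₂) (Sum.inl a₃) (Sum.inl b)
      (Sum.inr () : V ⊕ Unit) :=
  ⟨Sum.inr_ne_inl, Sum.inr_ne_inl, Sum.inr_ne_inl, Sum.inr_ne_inl, Sum.inr_ne_inl⟩

/-- **The series expansion**: an edge `f = {x, w}` of weight `s · t` is the path `x – y – w` through
the new vertex `y` with the weights `s` on `{x, y}` and `t` on `{y, w}`. -/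
theorem Gc_series_expand (p : E → R) {ends : E → Sym2 V} {f : E} {x w : V}
    (hf : ends f = s(x, w)) (hxw : x ≠ w) {s t : R} (hst : p f = s * t) (o a₁ a₂ a₃ b : V) :
    Gc p ends o a₁ a₂ a₃ b =
      Gc (Sum.elim (Function.update p f t) (fun _ : Unit => s)) (seriesEnds ends f x w)
        (Sum.inl o) (Sum.inl a₁) (Sum.inl a₂) (Sum.inl a₃) (Sum.inl b) := by
  -- the new vertex has exactly the two non-loop edges `{x, y}` and `{y, w}`
  have hdeg : ∀ g, g ≠ (Sum.inr () : E ⊕ Unit) → g ≠ Sum.inl f →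
      (Sum.inr () : V ⊕ Unit) ∈ seriesEnds ends f x w g → (seriesEnds ends f x w g).IsDiag := by
    intro g hge hgf hy
    rcases g with g | ⟨⟩
    · have hgf' : g ≠ f := fun h => hgf (by rw [h])
      rw [seriesEnds_inl_of_ne ends f x w hgf', Sym2.mem_map] at hy
      obtain ⟨a, _, ha⟩ := hy
      exact absurd ha Sum.inl_ne_inr
    · exact absurd rfl hge
  have h := WRed.Gc_series_at (Sum.elim (Function.update p f t) (fun _ : Unit => s))
    (ends := seriesEnds ends f x w) (e := Sum.inr ()) (f := Sum.inl f) (x := Sum.inl x)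
    (y := Sum.inr ()) (w := Sum.inl w) (seriesEnds_inr ends f x w ())
    (seriesEnds_inl_self ends f x w) Sum.inr_ne_inl Sum.inl_ne_inr Sum.inr_ne_inl
    (unmarked_inr o a₁ a₂ a₃ b) hdeg
  rw [h, contractRootEdge_seriesEnds ends hf hxw]
  simp only [Sum.elim_inl, Sum.elim_inr, Function.update_self]
  rw [series_weights p hst]
  exact Types.Gc_embed p (fun _ => 0) ends (loopAt x) (loopAt_isDiag x) o a₁ a₂ a₃ b

omit [DecidableEq V] in
/-- **The parallel expansion**: an edge `f` of weight `t + s − t s` is the pair of parallel edges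
`f` (weight `t`) and `Sum.inr ()` (weight `s`). -/
theorem Gc_parallel_expand (p : E → R) {ends : E → Sym2 V} (f : E) (x : V) {s t : R}
    (hst : p f = t + s - t * s) (o a₁ a₂ a₃ b : V) :
    Gc p ends o a₁ a₂ a₃ b =
      Gc (Sum.elim (Function.update p f t) (fun _ : Unit => s)) (parallelEnds ends f)
        (Sum.inl o) (Sum.inl a₁) (Sum.inl a₂) (Sum.inl a₃) (Sum.inl b) := by
  have h := RECM.Gc_parallel (Sum.elim (Function.update p f t) (fun _ : Unit => s))
    (ends := parallelEnds ends f) (g₁ := Sum.inl f) (g₂ := Sum.inr ()) Sum.inl_ne_inr rfl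
    (Sum.inl x) (Sum.inl o) (Sum.inl a₁) (Sum.inl a₂) (Sum.inl a₃) (Sum.inl b)
  rw [h, update_parallelEnds ends f x]
  simp only [Sum.elim_inl, Sum.elim_inr, Function.update_self]
  rw [parallel_weights p hst]
  exact Types.Gc_embed p (fun _ => 0) ends (loopAt x) (loopAt_isDiag x) o a₁ a₂ a₃ b

end Main

end Expand

end Summit.Ventures.PercRepro2
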